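import Summits.QuantumFields.YangMills.Theorems.BalabanUVNodesN21ThresholdMixtureRStepLocalityRaw

/-!
# N21 (NE7c), strategy s3 «alternative currency», file 27 — THE RAW ROAD REPAIRED (ROW L′'s `huniq` road, correctly conditioned): with a SUPPORT-LOCAL
# regularity class the solvable set of (2.12) is NEAR-LOCAL (r11's splice lemma with its admissibility witness replaced by «the datum is regular on the
# all-`Γ₀` plaquettes»), and under a displayed PLAQUETTE-UNIQUENESS hypothesis the RAW χ-slot statistic of `U_{k,□}(·)` is fibre-independent of every
# fibre missing the local read set — 22b's road at raw `bgOfRecord` letters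

HEADER — WORK-UNIT METADATA.  Seat `pub-ymgap-dag-n21-e` (R141 (C) fan-out, node N21 = NE7c `T4IndicatorShell.ShellWeightBound`, strategy s3), g9, file 27;
sequel of file 26 (`…RStepLocalityRaw`: the raw road is DEAD under the record's GLOBAL class `{U | PlaqSmall δ U}` — one far large plaquette empties the
solvable set and the totalised map reads `1`).  Lane: `--kind proof --supports stmt-QuantumFields-20296 --as helper` (K3⁵ `SpineGivenEndpointR13SepCoP`).  Count-neutral.

THE CONTENT.  Objects BY NAME as in file 26, plus r11's splice `B14.Eq12InteriorLocality.spliceCfg 𝔹 X Ũ` (datum on the `Γ₀`-bonds, `Ũ` inside), its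
near sites ∕ near determining set `nearSites` ∕ `near`, `rep`, `normalise`, and 22c's `plaqHol_ukBox_normalise_congr`.
(R1) `isMinimizer_spliceCfg_of_datumGood` — r11's `isMinimizer_spliceCfg` WITH ITS ADMISSIBILITY WITNESS `hW : IsMinimizer … X W` REPLACED by the only
     thing its proof draws from `W`: the datum `X₀` is `good` on every all-`Γ₀` plaquette (r11's proof reads `W` exactly there — the splice equals `W` on
     those plaquettes; adapted with credit, the constraint and minimality parts verbatim).  Plaquette forms of the splice: `plaqHol_spliceCfg_of_ext` ∕
     `plaqHol_spliceCfg_of_not_ext`.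
(R2) THE SOLVABLE SET IS NEAR-LOCAL FOR A SUPPORT-LOCAL CLASS.  If membership in `reg` is plaquette-wise (`good`) and the FAR all-`Γ₀` plaquettes — those not
     inside `bondsOf (nearSites 𝔹)` — are UNCONSTRAINED (`good p = univ` there; e.g. `PlaqSmallOn` over the near plaquettes), then `AgreeOn (near 𝔹) X X̃` and
     `X̃` solvable ⇒ `X` solvable (`solvable_of_agreeOn_near`; the near all-`Γ₀` plaquettes of `X₀` equal those of `X̃₀ = Ũ`), hence
     `solvable_iff_of_agreeOn_near`.  Contrast file 26: under the GLOBAL class solvability reads every far plaquette.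
(R3) THE RAW ROAD UNDER PLAQUETTE-UNIQUENESS.  `huniq` (displayed, NOT asserted — the consequence form of [15] Thm 1's uniqueness-mod-gauge on the tested
     plaquettes `T`: any two (2.12) minimisers for one datum have equal `dist1 (U(∂p))`, `p ∈ T`).  Then at (2.16) letters, for `T` avoiding the far
     `Γ₀`-bonds and a fibre `s` missing the local read set `liftIter k (inputs (near 𝐁_k(□^{≈4})))`: ON the solvable set the raw totalised map and the
     normalised map are both minimisers for the datum, so their `T`-statistics agree (`dist1_plaqHol_ukBox_raw_eq_normalise`), the normalised one is
     fibre-local (22c) and the solvable set is fibre-local (R2); OFF it both updated and un-updated raw configurations are the unit configuration — whence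
     ★★ `fibreIndep_supStat_ukBox_raw_of_huniq`: 22b's `hlocP`-CONCLUSION (`FibreIndep s` of the block-sup statistic) HOLDS AT RAW LETTERS for a support-local
     class.  NET FOR ROW L′ (def-R ∕ def-χ): raw road DEAD under the global class (file 26), ALIVE under «support-local class + [15]-uniqueness» (this file);
     `normalise` (22c) needs neither hypothesis.

HONEST FRAMING.  NE7c is NOT PRINTED and NOT PROVED.  [folklore] bookkeeping over r11 ∕ r12 ∕ def-R letters; `huniq` and every solvability premise are
DISPLAYED HYPOTHESES ([15] = [Balaban1985PropagatorsII] Thm 1 is NOT in the tree and NOT asserted); the record's class is the GLOBAL one, so (R2)–(R3) are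
statements about a re-typed class, not about the record as it stands; N21 NOT discharged; counts UNMOVED; count-neutral; one finite 𝕋⁴ at fixed `ε`;
NOT ℝ⁴ ∕ OS ∕ mass gap ∕ Clay.

CITATION HEADER (lean-in-tree rule 2026-08-18).  BY NAME: r11 `B14.Eq12InteriorLocality.spliceCfg` ∕ `spliceCfg_of_ext` ∕ `spliceCfg_of_not_ext` ∕
`mem_bondsOf_nearSites_of_plaq` ∕ `mem_bondsOf_nearSites_of_inputsPos` ∕ `mem_inputsPos` ∕ `action_splice_add` ∕ `near` ∕ `nearSites` ∕ `near_range` ∕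
`Bj_standingRange` ∕ `normalise` ∕ `isMinimizer_normalise` ∕ `plaqBonds` ∕ `plaqHol_congr` ∕ `farBonds`; r11 `B14.Eq216Concrete.ukBox` ∕ `iter_local` ∕ `feeds` ∕
`agreeOn_avgFamily` ∕ `qsstarGIter0_local` ∕ `liftIter` ∕ `inputs`; r12 `B15DeterminingSets.IsMinimizer` ∕ `AgreeOn` ∕ `avgFamily` ∕ `extBonds` ∕ `bondsOf`;
def-R `Node00.UminOfRecord` ∕ `UminOfRecord_of_not` ∕ `isMinimizer_UminOfRecord` ∕ `bgOfRecord`; 22c `plaqHol_ukBox_normalise_congr`; 26 `plaqHol_eq_datum_of_isMinimizer`.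
Context only (SHAPE, nothing asserted): [Balaban1988Convergent] (2.2) p. 255, (2.10)–(2.13) p. 256, (2.16)–(2.17) p. 257; [Balaban1985PropagatorsII] Thm 1 (the
shape of `huniq`).

WHAT IS PROVED ([folklore]).  (R1) `plaqHol_spliceCfg_of_ext` · `plaqHol_spliceCfg_of_not_ext` · ★ `isMinimizer_spliceCfg_of_datumGood`; (R2) ★ `solvable_of_agreeOn_near` ·
`solvable_iff_of_agreeOn_near`; (R3) `agreeOn_near_datum_of_updateFinset` · `dist1_plaqHol_ukBox_raw_eq_normalise` · ★★ `fibreIndep_supStat_ukBox_raw_of_huniq`.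
-/

set_option autoImplicit false

noncomputable section

open Set
open scoped BigOperators

namespace Summit.QuantumFields.YangMills.Theorems.N21ThresholdMixtureRStepLocalityRawRepaired

open Literature.MathematicalPhysics.QuantumFieldTheory.Balaban1983to89
open B15DeterminingSets B14.Eq213DetSet B14.Eq216Concrete B14.Eq12InteriorLocality
open Literature.MathematicalPhysics.QuantumFieldTheory.BalabanImbrieJaffe1984to88.BIJ85Eq453GaugeField
open Literature.MathematicalPhysics.QuantumFieldTheory.Balaban1983to89.Node00
  (UminOfRecord UminOfRecord_of_not isMinimizer_UminOfRecord bgOfRecord)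
open Literature.MathematicalPhysics.QuantumFieldTheory.Balaban1983to89.T4DressedR (FibreIndep)
open Summit.QuantumFields.YangMills.Theorems.N21ThresholdMixtureRStepLocalityNormalise (plaqHol_ukBox_normalise_congr)
open Summit.QuantumFields.YangMills.Theorems.N21ThresholdMixtureRStepLocalityRaw (plaqHol_eq_datum_of_isMinimizer)

/-! ## (R1) r11's splice lemma with the admissibility witness replaced by «the datum is regular on the all-`Γ₀` plaquettes» -/

section Splice

variable {P : Params} {G : Type*} [GaugeGroup G]

/-- On an all-`Γ₀` plaquette the splice `(X₀ ∣ Ũ)` has the DATUM's plaquette variable. [cite: Balaban1988Convergent, (2.12) p.256] -/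
theorem plaqHol_spliceCfg_of_ext (𝔹 : DetSet P) (X : MSField P G) (Ut : GaugeField P 0 G) {p : Plaq P 0}
    (hp : plaqBonds p ⊆ extBonds 𝔹) : GaugeField.plaqHol (spliceCfg 𝔹 X Ut) p = GaugeField.plaqHol (X 0) p :=
  plaqHol_congr fun _ hb => spliceCfg_of_ext X Ut (hp hb)

/-- On a plaquette meeting the interior the splice `(X₀ ∣ Ũ)` has `Ũ`'s plaquette variable (its `Γ₀`-bonds are near, where `X₀ = X̃₀ = Ũ`).
[cite: Balaban1988Convergent, (2.12) p.256] -/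
theorem plaqHol_spliceCfg_of_not_ext (𝔹 : DetSet P) {X Xt : MSField P G} (hXt : AgreeOn (near 𝔹) X Xt) {Ut : GaugeField P 0 G}
    (hUt : ∀ b ∈ extBonds 𝔹, Ut b = Xt 0 b) {p : Plaq P 0} (hp : ¬ plaqBonds p ⊆ extBonds 𝔹) :
    GaugeField.plaqHol (spliceCfg 𝔹 X Ut) p = GaugeField.plaqHol Ut p :=
  plaqHol_congr fun b hb => by
    by_cases hbE : b ∈ extBonds 𝔹
    · rw [spliceCfg_of_ext X Ut hbE, hUt b hbE]
      exact hXt 0 b (mem_bondsOf_nearSites_of_plaq hp hb hbE)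
    · rw [spliceCfg_of_not_ext X Ut hbE]

/-- ★ (R1) **THE SPLICE IS A MINIMAL CONFIGURATION — WITNESS-FREE EDITION.**  r11's `isMinimizer_spliceCfg` with the hypothesis «`X` admits a minimiser `W`»
replaced by «`X₀` is `good` on every all-`Γ₀` plaquette» (the only use r11's proof makes of `W`): for a plaquette-wise class, a determining set of the
standing range, data `X`, `X̃` agreeing on `near 𝔹` and a minimiser `Ũ` for `X̃`, the splice `(X₀ ∣ Ũ)` is a minimiser for `X`.  Constraint and minimality
parts as in r11 (transport of competitors, `action_splice_add`); adapted with credit. [cite: Balaban1988Convergent, (2.12) p.256] -/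
theorem isMinimizer_spliceCfg_of_datumGood {reg : Set (GaugeField P 0 G)} {good : Plaq P 0 → Set G}
    (hgood : ∀ U, U ∈ reg ↔ ∀ p, GaugeField.plaqHol U p ∈ good p) {av : ∀ j, Averaging P j G}
    {𝔹 : DetSet P} (h𝔹 : ∀ j, P.m + P.K < j → 𝔹 j = ∅) {X Xt : MSField P G} (hXt : AgreeOn (near 𝔹) X Xt)
    (hXgood : ∀ p, plaqBonds p ⊆ extBonds 𝔹 → GaugeField.plaqHol (X 0) p ∈ good p)
    {Ut : GaugeField P 0 G} (hUt : IsMinimizer av reg 𝔹 Xt Ut) :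
    IsMinimizer av reg 𝔹 X (spliceCfg 𝔹 X Ut) := by
  have hUext : ∀ b ∈ extBonds 𝔹, Ut b = Xt 0 b := fun b hb => hUt.2.1 0 b hb
  -- the splice agrees with `Ũ` on every bond feeding a higher layer
  have hfeed : ∀ {j : ℕ} {b : PBond P (j + 1)}, b ∈ bondsOf (𝔹 (j + 1)) →
      ∀ b₀ ∈ feeds (j + 1) b, spliceCfg 𝔹 X Ut b₀ = Ut b₀ := by
    intro j b hb b₀ hb₀
    by_cases hbE : b₀ ∈ extBonds 𝔹
    · rw [spliceCfg_of_ext X Ut hbE, hUext b₀ hbE]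
      exact hXt 0 b₀ (mem_bondsOf_nearSites_of_inputsPos (mem_inputsPos.2 ⟨j, b, hb, hb₀⟩) hbE)
    · rw [spliceCfg_of_not_ext X Ut hbE]
  refine ⟨?_, ?_, ?_⟩
  · -- regularity, plaquette-wise: the datum on the all-`Γ₀` plaquettes (HYPOTHESIS), `Ũ` elsewhere
    refine (hgood _).2 fun p => ?_
    by_cases hp : plaqBonds p ⊆ extBonds 𝔹
    · rw [plaqHol_spliceCfg_of_ext 𝔹 X Ut hp]
      exact hXgood p hp
    · rw [plaqHol_spliceCfg_of_not_ext 𝔹 hXt hUext hp]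
      exact (hgood Ut).1 hUt.1 p
  · -- the constraint `M_𝔹(X₀ ∣ Ũ) = X`
    intro j b hb
    cases j with
    | zero => exact spliceCfg_of_ext X Ut hb
    | succ j =>
      by_cases hj : j + 1 ≤ P.m + P.K
      · show Averaging.iter av (j + 1) (spliceCfg 𝔹 X Ut) b = X (j + 1) b
        rw [iter_local av (j + 1) hj (spliceCfg 𝔹 X Ut) Ut b (hfeed hb), hXt (j + 1) b hb]
        exact hUt.2.1 (j + 1) b hb
      · rw [h𝔹 (j + 1) (not_le.1 hj)] at hb
        simp [bondsOf] at hb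
  · -- minimality: transport a competitor `U` for `X` to the competitor `(X̃₀ ∣ U)` for `X̃`
    intro U hUreg hUc
    have hUext' : ∀ b ∈ extBonds 𝔹, U b = X 0 b := fun b hb => hUc 0 b hb
    have hXt' : AgreeOn (near 𝔹) Xt X := fun j b hb => (hXt j b hb).symm
    have hcomp_reg : spliceCfg 𝔹 Xt U ∈ reg := by
      refine (hgood _).2 fun p => ?_
      by_cases hp : plaqBonds p ⊆ extBonds 𝔹
      · rw [plaqHol_spliceCfg_of_ext 𝔹 Xt U hp, ← plaqHol_eq_datum_of_isMinimizer hUt hp]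
        exact (hgood Ut).1 hUt.1 p
      · rw [plaqHol_spliceCfg_of_not_ext 𝔹 hXt' hUext' hp]
        exact (hgood U).1 hUreg p
    have hcomp_c : AgreeOn 𝔹 (avgFamily av (spliceCfg 𝔹 Xt U)) Xt := by
      intro j b hb
      cases j with
      | zero => exact spliceCfg_of_ext Xt U hb
      | succ j =>
        by_cases hj : j + 1 ≤ P.m + P.K
        · have hfeed' : ∀ b₀ ∈ feeds (j + 1) b, spliceCfg 𝔹 Xt U b₀ = U b₀ := by
            intro b₀ hb₀
            by_cases hbE : b₀ ∈ extBonds 𝔹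
            · rw [spliceCfg_of_ext Xt U hbE, hUext' b₀ hbE]
              exact (hXt 0 b₀ (mem_bondsOf_nearSites_of_inputsPos (mem_inputsPos.2 ⟨j, b, hb, hb₀⟩) hbE)).symm
            · rw [spliceCfg_of_not_ext Xt U hbE]
          show Averaging.iter av (j + 1) (spliceCfg 𝔹 Xt U) b = Xt (j + 1) b
          rw [iter_local av (j + 1) hj (spliceCfg 𝔹 Xt U) U b hfeed', ← hXt (j + 1) b hb]
          exact hUc (j + 1) b hb
        · rw [h𝔹 (j + 1) (not_le.1 hj)] at hb
          simp [bondsOf] at hb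
    have hle : wilsonAction4 Ut ≤ wilsonAction4 (spliceCfg 𝔹 Xt U) := hUt.2.2 _ hcomp_reg hcomp_c
    have hsum := action_splice_add 𝔹 hXt hUext hUext'
    linarith

/-! ## (R2) The solvable set of (2.12) is NEAR-LOCAL for a support-local class -/

/-- ★ (R2) **NEAR-LOCALITY OF SOLVABILITY FOR A SUPPORT-LOCAL CLASS**: if the class constrains plaquettes plaquette-wise and leaves the FAR all-`Γ₀`
plaquettes (those not inside `bondsOf (nearSites 𝔹)`) free, then data agreeing on `near 𝔹` are solvable together. [cite: Balaban1988Convergent, (2.12) p.256] -/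
theorem solvable_of_agreeOn_near {reg : Set (GaugeField P 0 G)} {good : Plaq P 0 → Set G}
    (hgood : ∀ U, U ∈ reg ↔ ∀ p, GaugeField.plaqHol U p ∈ good p) {av : ∀ j, Averaging P j G}
    {𝔹 : DetSet P} (h𝔹 : ∀ j, P.m + P.K < j → 𝔹 j = ∅)
    (hfree : ∀ p, plaqBonds p ⊆ extBonds 𝔹 → ¬ plaqBonds p ⊆ bondsOf (nearSites 𝔹) → ∀ g, g ∈ good p)
    {X Xt : MSField P G} (hXt : AgreeOn (near 𝔹) X Xt) (hsol : ∃ Ut, IsMinimizer av reg 𝔹 Xt Ut) :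
    ∃ W, IsMinimizer av reg 𝔹 X W := by
  obtain ⟨Ut, hUt⟩ := hsol
  refine ⟨_, isMinimizer_spliceCfg_of_datumGood hgood h𝔹 hXt (fun p hp => ?_) hUt⟩
  by_cases hnear : plaqBonds p ⊆ bondsOf (nearSites 𝔹)
  · have h : GaugeField.plaqHol (X 0) p = GaugeField.plaqHol Ut p :=
      plaqHol_congr fun b hb => (hXt 0 b (hnear hb)).trans (hUt.2.1 0 b (hp hb)).symm
    rw [h]
    exact (hgood Ut).1 hUt.1 p
  · exact hfree p hp hnear _

/-- (R2′) … in `iff` form. [cite: Balaban1988Convergent, (2.12) p.256] -/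
theorem solvable_iff_of_agreeOn_near {reg : Set (GaugeField P 0 G)} {good : Plaq P 0 → Set G}
    (hgood : ∀ U, U ∈ reg ↔ ∀ p, GaugeField.plaqHol U p ∈ good p) {av : ∀ j, Averaging P j G}
    {𝔹 : DetSet P} (h𝔹 : ∀ j, P.m + P.K < j → 𝔹 j = ∅)
    (hfree : ∀ p, plaqBonds p ⊆ extBonds 𝔹 → ¬ plaqBonds p ⊆ bondsOf (nearSites 𝔹) → ∀ g, g ∈ good p)
    {X Xt : MSField P G} (hXt : AgreeOn (near 𝔹) X Xt) :
    (∃ W, IsMinimizer av reg 𝔹 X W) ↔ ∃ Ut, IsMinimizer av reg 𝔹 Xt Ut :=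
  ⟨solvable_of_agreeOn_near hgood h𝔹 hfree (fun j b hb => (hXt j b hb).symm),
    solvable_of_agreeOn_near hgood h𝔹 hfree hXt⟩

end Splice

/-! ## (R3) The raw road at (2.16) letters under plaquette-uniqueness -/

section Raw

variable {P : Params} {G : Type*} [GaugeGroup G] [MeasurableSpace G] (av : ∀ j, Averaging P j G) (M₁ : ℕ)

omit [MeasurableSpace G] in
/-- (R3-a) Updating `V` on a fibre missing the local read set `liftIter k (inputs (near 𝐁_k(□^{≈4})))` leaves the (2.16) datum `M˙(Q_k^{s*}V)` unchanged on
`near 𝐁_k(□^{≈4})` (r11 `agreeOn_avgFamily` ∘ `qsstarGIter0_local`). [cite: Balaban1988Convergent, (1.3) p.246, (2.10) p.256, (2.16) p.257] -/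
theorem agreeOn_near_datum_of_updateFinset {box4 : Set (Site P 0)} {k : ℕ} [DecidableEq (PBond P k)] (hk : k ≤ P.m + P.K)
    (s : Finset (PBond P k)) (hdisj : ∀ c ∈ liftIter k (inputs (near (Bj M₁ box4 k))), c ∉ s) (V : GaugeField P k G) (y : s → G) :
    AgreeOn (near (Bj M₁ box4 k)) (avgFamily av (qsstarGIter0 k (Function.updateFinset V s y))) (avgFamily av (qsstarGIter0 k V)) :=
  agreeOn_avgFamily av (near (Bj M₁ box4 k)) (near_range (Bj_standingRange M₁ box4 hk)) _ _
    (qsstarGIter0_local k (inputs (near (Bj M₁ box4 k))) _ _ fun c hc => by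
      simp only [Function.updateFinset, dif_neg (hdisj c hc)])

/-- (R3-b) **ON THE SOLVABLE SET, RAW AND NORMALISED STATISTICS AGREE UNDER PLAQUETTE-UNIQUENESS**: both the totalised raw map and the normalised map
are (2.12) minimisers for the same datum. [cite: Balaban1988Convergent, (2.12) p.256, (2.16)–(2.17) p.257] -/
theorem dist1_plaqHol_ukBox_raw_eq_normalise {reg : Set (GaugeField P 0 G)} (hreg : PlaqDetermined reg) {box4 : Set (Site P 0)} {k : ℕ}
    (T : Set (Plaq P 0))
    (huniq : ∀ (X : MSField P G) (U₀ U₁ : GaugeField P 0 G), IsMinimizer av reg (Bj M₁ box4 k) X U₀ → IsMinimizer av reg (Bj M₁ box4 k) X U₁ →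
      ∀ p ∈ T, dist1 (GaugeField.plaqHol U₀ p) = dist1 (GaugeField.plaqHol U₁ p))
    {V : GaugeField P k G} (hsol : ∃ U₀, IsMinimizer av reg (Bj M₁ box4 k) (avgFamily av (qsstarGIter0 k V)) U₀) {p : Plaq P 0} (hp : p ∈ T) :
    dist1 (GaugeField.plaqHol (ukBox (bgOfRecord av reg) M₁ box4 k V) p)
      = dist1 (GaugeField.plaqHol (ukBox (normalise (bgOfRecord av reg) hreg) M₁ box4 k V) p) :=
  huniq _ _ _ ((bgOfRecord av reg).isMinimizer _ _ hsol) (isMinimizer_normalise (bgOfRecord av reg) hreg _ hsol) p hp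

/-- ★★ (R3) **THE RAW ROAD REPAIRED: 22b's `hlocP`-CONCLUSION AT RAW `bgOfRecord` LETTERS FOR A SUPPORT-LOCAL CLASS UNDER PLAQUETTE-UNIQUENESS.**  For a
plaquette-wise class leaving the far all-`Γ₀` plaquettes of `𝐁_k(□^{≈4})` free, a tested family `T` avoiding the far `Γ₀`-bonds, `huniq` on `T` (displayed —
[15] Thm 1's consequence, NOT asserted) and a fibre `s` missing the local read set, the RAW block-sup statistic `V ↦ ⨆_{p ∈ T} |U_{k,□}(V)(∂p) − 1|` is
fibre-independent of `s`: on the solvable set via the normalised map (22c) and (R3-b), off it both configurations are the unit configuration, and the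
solvable set itself is fibre-local by (R2). [cite: Balaban1988Convergent, (2.12) p.256, (2.16)–(2.17) p.257] -/
theorem fibreIndep_supStat_ukBox_raw_of_huniq {reg : Set (GaugeField P 0 G)} {good : Plaq P 0 → Set G}
    (hgood : ∀ U, U ∈ reg ↔ ∀ p, GaugeField.plaqHol U p ∈ good p) {box4 : Set (Site P 0)} {k : ℕ} [DecidableEq (PBond P k)]
    (hk : k ≤ P.m + P.K)
    (hfree : ∀ p, plaqBonds p ⊆ extBonds (Bj M₁ box4 k) → ¬ plaqBonds p ⊆ bondsOf (nearSites (Bj M₁ box4 k)) → ∀ g, g ∈ good p)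
    (T : Set (Plaq P 0)) (hT : ∀ p ∈ T, ∀ b ∈ plaqBonds p, b ∉ farBonds (Bj M₁ box4 k))
    (huniq : ∀ (X : MSField P G) (U₀ U₁ : GaugeField P 0 G), IsMinimizer av reg (Bj M₁ box4 k) X U₀ → IsMinimizer av reg (Bj M₁ box4 k) X U₁ →
      ∀ p ∈ T, dist1 (GaugeField.plaqHol U₀ p) = dist1 (GaugeField.plaqHol U₁ p))
    (s : Finset (PBond P k)) (hdisj : ∀ c ∈ liftIter k (inputs (near (Bj M₁ box4 k))), c ∉ s) :
    FibreIndep s fun V => ⨆ p : T, dist1 (GaugeField.plaqHol (ukBox (bgOfRecord av reg) M₁ box4 k V) p.1) := by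
  have hreg : PlaqDetermined reg := ⟨good, hgood⟩
  intro V y
  have hagree := agreeOn_near_datum_of_updateFinset av M₁ hk s hdisj V y
  have hVW : ∀ c ∈ liftIter k (inputs (near (Bj M₁ box4 k))), Function.updateFinset V s y c = V c := fun c hc => by
    simp only [Function.updateFinset, dif_neg (hdisj c hc)]
  by_cases hsol : ∃ U₀, IsMinimizer av reg (Bj M₁ box4 k) (avgFamily av (qsstarGIter0 k V)) U₀
  · -- ON the solvable set: raw = normalised (huniq), normalised fibre-local (22c), solvability fibre-local (R2)
    have hsol' : ∃ U₀, IsMinimizer av reg (Bj M₁ box4 k) (avgFamily av (qsstarGIter0 k (Function.updateFinset V s y))) U₀ :=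
      solvable_of_agreeOn_near hgood (Bj_standingRange M₁ box4 hk) hfree hagree hsol
    refine iSup_congr fun p => ?_
    rw [dist1_plaqHol_ukBox_raw_eq_normalise av M₁ hreg T huniq hsol' p.2, dist1_plaqHol_ukBox_raw_eq_normalise av M₁ hreg T huniq hsol p.2,
      plaqHol_ukBox_normalise_congr (bgOfRecord av reg) M₁ hreg hk hVW (hT p.1 p.2)]
  · -- OFF the solvable set: both raw configurations are the unit configuration
    have hsol' : ¬ ∃ U₀, IsMinimizer av reg (Bj M₁ box4 k) (avgFamily av (qsstarGIter0 k (Function.updateFinset V s y))) U₀ :=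
      fun h => hsol (solvable_of_agreeOn_near hgood (Bj_standingRange M₁ box4 hk) hfree (fun j b hb => (hagree j b hb).symm) h)
    have h1 : ukBox (bgOfRecord av reg) M₁ box4 k (Function.updateFinset V s y) = fun _ => 1 := UminOfRecord_of_not av reg hsol'
    have h2 : ukBox (bgOfRecord av reg) M₁ box4 k V = fun _ => 1 := UminOfRecord_of_not av reg hsol
    show (⨆ p : T, dist1 (GaugeField.plaqHol (ukBox (bgOfRecord av reg) M₁ box4 k (Function.updateFinset V s y)) p.1))
      = ⨆ p : T, dist1 (GaugeField.plaqHol (ukBox (bgOfRecord av reg) M₁ box4 k V) p.1)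
    rw [h1, h2]

end Raw

end Summit.QuantumFields.YangMills.Theorems.N21ThresholdMixtureRStepLocalityRawRepaired

end
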